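import Mathlib
import HarnessLib
import Summits.Ventures.LatticeQCDFlow.Exactness.U1FTHMCErgodic
import Summits.Ventures.LatticeQCDFlow.Exactness.SU2MaskedKickScheduleErgodic

/-!
# FT-HMC (single-step leapfrog) through the engine's WHOLE `U(1)` LO Wilson-flow member — any schedule — is uniformly ergodic

HONEST FRAMING: exact (Metropolis-corrected) sampling algorithms for lattice gauge theory;
figures of merit are autocorrelation/cost numbers at stated couplings and volumes; no
continuum-physics claim.

Venture `LatticeQCDFlow` (cell pub-lqcd), topic `Exactness`; FANOUT row 14 (`eng-flowhmc`, engine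
`latflow.fthmc`, family B; member `maps.u1_wilson_flow_lo` = a schedule of masked Euler sub-steps
with a running log-det).  NEW WORK of the cell; nothing is cited as a fact; no number.
`U1FTHMCErgodic.lean` did ONE sub-step.  Here the whole member, packaged VERBATIM as in
`U1WilsonFlowLOSubstep.exists_layers_u1WilsonFlowLO` and composed by
`NCPLayerEquiv.hasJacobian_foldr_trans`:

* **`u1WilsonFlowLO_member_fthmc_uniformlyErgodic`** — proper colouring, `2(d−1)|ε| < 1`, ANY
  schedule `sched : List (Fin d × X)`: every packaged layer density is pinched in
  `[(1 − κ₀)^(#edges), (1 + κ₀)^(#edges)]` (`u1WilsonFlowLOJacobian_mem_Icc`, `κ₀ = 2(d−1)|ε|`), so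
  the running density is pinched (`foldr_logDet_mem_Icc`) and row 9's reported single-step
  leapfrog FT-HMC kernel through the composite member converges to `π_S` geometrically in total
  variation from every initial law (`u1LeapfrogFTHMC_uniformlyErgodic`);
  **`u1WilsonFlowLO_member_fthmc_invariant_unique`** — `π_S` is its unique invariant law.

NOT CLAIMED: multi-step trajectories / OMF words; the learned `U(1)` members; any usable `δ`;
floating point; any number.
-/

noncomputable section

namespace Summit.Ventures.LatticeQCDFlow.Exactness

open MeasureTheory ProbabilityTheory ProbabilityTheory.Kernel Set
open Literature.MathematicalPhysics.QuantumFieldTheory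
open scoped ENNReal

variable {d L : ℕ} {X : Type*} [DecidableEq X] (χ : Site d L → X) [NeZero L]

/-- Every layer packaged by `exists_layers_u1WilsonFlowLO` has its density pinched uniformly:
`(1 − κ₀)^(#edges) ≤ J_s ≤ (1 + κ₀)^(#edges)`. -/
theorem u1WilsonFlowLO_layers_pinched {ε : ℝ} (hε : |ε| * (2 * ((d - 1 : ℕ) : ℝ)) ≤ 1)
    (sched : List (Fin d × X)) (layers : List ((GaugeConfig d L Circle ≃ᵐ GaugeConfig d L Circle) × (GaugeConfig d L Circle → ℝ)))
    (hmap :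
      layers.map (fun Ly => ((Ly.1 : GaugeConfig d L Circle → GaugeConfig d L Circle), Ly.2)) = sched.map (fun s =>
        ((fun (V : GaugeConfig d L Circle) (e : Edge d L) => if e.2 = s.1 ∧ χ e.1 = s.2 then
          V e * Circle.exp (ε * ∑ ν ∈ Finset.univ.erase e.2,
            (((plaquetteHolonomy V (e.1 - Pi.single ν 1) e.2 ν : Circle) : ℂ).im -
              ((plaquetteHolonomy V e.1 e.2 ν : Circle) : ℂ).im)) else V e),
         fun V : GaugeConfig d L Circle => ∏ a : {e : Edge d L // e.2 = s.1 ∧ χ e.1 = s.2},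
          (1 - ε * ∑ ν ∈ Finset.univ.erase a.1.2,
            (((plaquetteHolonomy V a.1.1 a.1.2 ν : Circle) : ℂ).re +
              ((plaquetteHolonomy V (a.1.1 - Pi.single ν 1) a.1.2 ν : Circle) : ℂ).re))))) :
    ∀ Ly ∈ layers, ∀ V, Ly.2 V ∈
      Icc ((1 - |ε| * (2 * ((d - 1 : ℕ) : ℝ))) ^ Fintype.card (Edge d L))
        ((1 + |ε| * (2 * ((d - 1 : ℕ) : ℝ))) ^ Fintype.card (Edge d L)) := by
  intro Ly hLy V
  have hmem : ((Ly.1 : GaugeConfig d L Circle → GaugeConfig d L Circle), Ly.2) ∈ sched.map (fun s =>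
        ((fun (V : GaugeConfig d L Circle) (e : Edge d L) => if e.2 = s.1 ∧ χ e.1 = s.2 then
          V e * Circle.exp (ε * ∑ ν ∈ Finset.univ.erase e.2,
            (((plaquetteHolonomy V (e.1 - Pi.single ν 1) e.2 ν : Circle) : ℂ).im -
              ((plaquetteHolonomy V e.1 e.2 ν : Circle) : ℂ).im)) else V e),
         fun V : GaugeConfig d L Circle => ∏ a : {e : Edge d L // e.2 = s.1 ∧ χ e.1 = s.2},
          (1 - ε * ∑ ν ∈ Finset.univ.erase a.1.2,
            (((plaquetteHolonomy V a.1.1 a.1.2 ν : Circle) : ℂ).re +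
              ((plaquetteHolonomy V (a.1.1 - Pi.single ν 1) a.1.2 ν : Circle) : ℂ).re)))) := by
    rw [← hmap]
    exact List.mem_map.mpr ⟨Ly, hLy, rfl⟩
  obtain ⟨s, -, hs⟩ := List.mem_map.mp hmem
  have hJ2 : Ly.2 = fun V : GaugeConfig d L Circle => ∏ a : {e : Edge d L // e.2 = s.1 ∧ χ e.1 = s.2},
          (1 - ε * ∑ ν ∈ Finset.univ.erase a.1.2,
            (((plaquetteHolonomy V a.1.1 a.1.2 ν : Circle) : ℂ).re +
              ((plaquetteHolonomy V (a.1.1 - Pi.single ν 1) a.1.2 ν : Circle) : ℂ).re)) := (Prod.mk.inj hs).2.symm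
  have h := u1WilsonFlowLOJacobian_mem_Icc χ s.1 s.2 hε V
  rw [hJ2]
  have hn : Fintype.card {e : Edge d L // e.2 = s.1 ∧ χ e.1 = s.2} ≤ Fintype.card (Edge d L) :=
    Fintype.card_subtype_le _
  have hκ0 : 0 ≤ |ε| * (2 * ((d - 1 : ℕ) : ℝ)) := mul_nonneg (abs_nonneg ε) (by positivity)
  refine ⟨le_trans ?_ h.1, h.2.trans ?_⟩
  · exact pow_le_pow_of_le_one (by linarith) (by linarith) hn
  · exact pow_le_pow_right₀ (by linarith) hn

/-- **FT-HMC (row 9's single-step leapfrog kernel) through the engine's whole `U(1)` LO Wilson-flow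
member — ANY schedule — is uniformly ergodic.**  Proper colouring, `2(d−1)|ε| < 1`; layers
packaged VERBATIM as in `exists_layers_u1WilsonFlowLO`; any measurable `|S| ≤ s`, `‖g‖ ≤ b`,
`ε', κ' > 0`. -/
theorem u1WilsonFlowLO_member_fthmc_uniformlyErgodic
    (hχ : ∀ (x : Site d L) (i : Fin d), χ (x.shift i) ≠ χ x) {ε : ℝ}
    (hε : |ε| * (2 * ((d - 1 : ℕ) : ℝ)) < 1) (sched : List (Fin d × X))
    {ε' κ' : ℝ} (hε' : 0 < ε') (hκ' : 0 < κ')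
    {g : GaugeConfig d L Circle → Edge d L → ℝ} (hg : Measurable g) {b' : ℝ} (hb0 : 0 ≤ b')
    (hb : ∀ u l, ‖g u l‖ ≤ b') {S : GaugeConfig d L Circle → ℝ} (hS : Measurable S) {s' : ℝ} (hs : ∀ u, |S u| ≤ s') :
    ∃ layers : List ((GaugeConfig d L Circle ≃ᵐ GaugeConfig d L Circle) × (GaugeConfig d L Circle → ℝ)),
      layers.map (fun Ly => ((Ly.1 : GaugeConfig d L Circle → GaugeConfig d L Circle), Ly.2)) = sched.map (fun s =>
        ((fun (V : GaugeConfig d L Circle) (e : Edge d L) => if e.2 = s.1 ∧ χ e.1 = s.2 then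
          V e * Circle.exp (ε * ∑ ν ∈ Finset.univ.erase e.2,
            (((plaquetteHolonomy V (e.1 - Pi.single ν 1) e.2 ν : Circle) : ℂ).im -
              ((plaquetteHolonomy V e.1 e.2 ν : Circle) : ℂ).im)) else V e),
         fun V : GaugeConfig d L Circle => ∏ a : {e : Edge d L // e.2 = s.1 ∧ χ e.1 = s.2},
          (1 - ε * ∑ ν ∈ Finset.univ.erase a.1.2,
            (((plaquetteHolonomy V a.1.1 a.1.2 ν : Circle) : ℂ).re +
              ((plaquetteHolonomy V (a.1.1 - Pi.single ν 1) a.1.2 ν : Circle) : ℂ).re)))) ∧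
      ∃ δ : ℝ, 0 < δ ∧ δ ≤ 1 ∧ ∀ (μ₀ : Measure (GaugeConfig d L Circle)) [IsProbabilityMeasure μ₀] (t : ℕ) (A : Set (GaugeConfig d L Circle)),
        |((fun m : Measure (GaugeConfig d L Circle) =>
              m.bind (conjKernel (u1LeapfrogHMC ε' κ' hg fun V => S ((layers.foldr (fun Ly (F : GaugeConfig d L Circle ≃ᵐ GaugeConfig d L Circle) => Ly.1.trans F) (MeasurableEquiv.refl (GaugeConfig d L Circle))) V) -
                Real.log ((layers.foldr (fun Ly K => fun v => Ly.2 v * K (Ly.1 v)) (fun _ => (1 : ℝ))) V)) (layers.foldr (fun Ly (F : GaugeConfig d L Circle ≃ᵐ GaugeConfig d L Circle) => Ly.1.trans F) (MeasurableEquiv.refl (GaugeConfig d L Circle)))))^[t] μ₀).real A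
            - (u1GibbsLaw S).real A| ≤ (1 - δ) ^ t := by
  obtain ⟨layers, hmap, hpos, hmeas, hjac⟩ := exists_layers_u1WilsonFlowLO χ hχ hε sched
  refine ⟨layers, hmap, ?_⟩
  obtain ⟨-, hfmeas, hfjac⟩ := hasJacobian_foldr_trans layers hpos hmeas hjac
  have hpinch := u1WilsonFlowLO_layers_pinched χ hε.le sched layers hmap
  have h0 : 0 < 1 - |ε| * (2 * ((d - 1 : ℕ) : ℝ)) := by linarith
  have hfold := fun v => foldr_logDet_mem_Icc layers (pow_nonneg h0.le _) hpinch v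
  exact u1LeapfrogFTHMC_uniformlyErgodic hε' hκ' hg hb0 hb hS hs
    (pow_pos (pow_pos h0 _) _) (fun v => (hfold v).1) (fun v => (hfold v).2) hfmeas hfjac

/-- **… and `π_S` is the unique invariant probability law of the member's reported kernel.** -/
theorem u1WilsonFlowLO_member_fthmc_invariant_unique
    (hχ : ∀ (x : Site d L) (i : Fin d), χ (x.shift i) ≠ χ x) {ε : ℝ}
    (hε : |ε| * (2 * ((d - 1 : ℕ) : ℝ)) < 1) (sched : List (Fin d × X))
    {ε' κ' : ℝ} (hε' : 0 < ε') (hκ' : 0 < κ')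
    {g : GaugeConfig d L Circle → Edge d L → ℝ} (hg : Measurable g) {b' : ℝ} (hb0 : 0 ≤ b')
    (hb : ∀ u l, ‖g u l‖ ≤ b') {S : GaugeConfig d L Circle → ℝ} (hS : Measurable S) {s' : ℝ} (hs : ∀ u, |S u| ≤ s') :
    ∃ layers : List ((GaugeConfig d L Circle ≃ᵐ GaugeConfig d L Circle) × (GaugeConfig d L Circle → ℝ)),
      layers.map (fun Ly => ((Ly.1 : GaugeConfig d L Circle → GaugeConfig d L Circle), Ly.2)) = sched.map (fun s =>
        ((fun (V : GaugeConfig d L Circle) (e : Edge d L) => if e.2 = s.1 ∧ χ e.1 = s.2 then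
          V e * Circle.exp (ε * ∑ ν ∈ Finset.univ.erase e.2,
            (((plaquetteHolonomy V (e.1 - Pi.single ν 1) e.2 ν : Circle) : ℂ).im -
              ((plaquetteHolonomy V e.1 e.2 ν : Circle) : ℂ).im)) else V e),
         fun V : GaugeConfig d L Circle => ∏ a : {e : Edge d L // e.2 = s.1 ∧ χ e.1 = s.2},
          (1 - ε * ∑ ν ∈ Finset.univ.erase a.1.2,
            (((plaquetteHolonomy V a.1.1 a.1.2 ν : Circle) : ℂ).re +
              ((plaquetteHolonomy V (a.1.1 - Pi.single ν 1) a.1.2 ν : Circle) : ℂ).re)))) ∧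
      ∀ (π' : Measure (GaugeConfig d L Circle)) [IsProbabilityMeasure π'],
        Invariant (conjKernel (u1LeapfrogHMC ε' κ' hg fun V => S ((layers.foldr (fun Ly (F : GaugeConfig d L Circle ≃ᵐ GaugeConfig d L Circle) => Ly.1.trans F) (MeasurableEquiv.refl (GaugeConfig d L Circle))) V) -
            Real.log ((layers.foldr (fun Ly K => fun v => Ly.2 v * K (Ly.1 v)) (fun _ => (1 : ℝ))) V)) (layers.foldr (fun Ly (F : GaugeConfig d L Circle ≃ᵐ GaugeConfig d L Circle) => Ly.1.trans F) (MeasurableEquiv.refl (GaugeConfig d L Circle)))) π' →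
        π' = u1GibbsLaw S := by
  obtain ⟨layers, hmap, hpos, hmeas, hjac⟩ := exists_layers_u1WilsonFlowLO χ hχ hε sched
  refine ⟨layers, hmap, fun π' _ hπ' => ?_⟩
  obtain ⟨-, hfmeas, hfjac⟩ := hasJacobian_foldr_trans layers hpos hmeas hjac
  have hpinch := u1WilsonFlowLO_layers_pinched χ hε.le sched layers hmap
  have h0 : 0 < 1 - |ε| * (2 * ((d - 1 : ℕ) : ℝ)) := by linarith
  have hfold := fun v => foldr_logDet_mem_Icc layers (pow_nonneg h0.le _) hpinch v
  exact u1LeapfrogFTHMC_invariant_unique hε' hκ' hg hb0 hb hS hs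
    (pow_pos (pow_pos h0 _) _) (fun v => (hfold v).1) (fun v => (hfold v).2) hfmeas hfjac hπ'

end Summit.Ventures.LatticeQCDFlow.Exactness
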